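import Summits.Ventures.Crystal3D.StickySpheres.ContactGraph
import Literature.Barriers.AtomisticToContinuum.StickySphereClustersNarrow
import HarnessLib

/-!
# The radius-one bridge: the cell's diameter-`1` contact numbers vs the tree's radius-`1` ones

HONEST FRAMING. Part of the venture `Summits/Ventures/Crystal3D` (cell `pub-crystal3d`, PLAN
amendment R3). The cell works with balls of DIAMETER `1` (`IsUnitPacking`, `numContacts`,
`maxContacts`, contact at distance `1`); the tree's discrete-geometry files work with balls of
RADIUS `1` (`Literature.Geometry.DiscreteGeometry.IsUnitBallPacking` on point sets,
`Literature.Barriers.AtomisticToContinuum.contactNumber` = pairs at distance `2`). This file proves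
the ONE scaling bridge between the two, so that radius-`1` results of the tree are quoted, never
re-proved. Everything here is proved; no claim about crystallization is made.

## Content

* `numContacts_eq_contactNumber_two_smul` — `C(x) = contactNumber (2 • x)`;
  `isUnitPacking_iff_two_smul` — `x` is a unit packing iff `2 • x` is injective with
  `IsUnitBallPacking (range (2 • x))`; the halving direction `isUnitPacking_half_smul`,
  `numContacts_half_smul`; hence `le_maxContacts_of_radiusOne` (a radius-`1` witness with `k`
  contacts gives `k ≤ C(N)`) and `maxContacts_le_of_radiusOne` (a radius-`1` universal bound
  transfers).
* Integer models at diameter `1`: `numContacts_intConfig`, `isUnitPacking_intConfig` for the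
  tree's scaled integer configurations `intConfig c (1/√m)` (contact at integer squared distance
  `m`, separation `≥ m`), so that kernel arithmetic (`decide`) certifies witnesses.
* Imported consequences (tree facts, not re-proved): `maxContacts_three_six : C(6) = 12` (from the
  tree's discharged six-ball enumeration `contactNumber_le_octahedralSix` and the octahedron), and
  `fccNucleus_le_maxContacts : 36 + 4k ≤ C(13 + k)` for `k ≤ 6` (the tree's fcc nuclei).

References: the tree files `Literature/Barriers/AtomisticToContinuum/StickySphereClusters*.lean`
(Arkus–Manoharan–Brenner 2009, Hoy–Harwayne-Gidansky–O'Hern 2012, Bezdek 2012 as cited there).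
-/

noncomputable section

open scoped BigOperators
open Finset

namespace Summit.Ventures.Crystal3D

open Literature.Geometry.DiscreteGeometry (IsUnitBallPacking sqNormInt intVec norm_intVec
  intVec_sub)
open Literature.Barriers.AtomisticToContinuum (contactNumber intContactNumber intConfig
  dist_intConfig octahedralSix octaInt fccNucleus fccNucleusInt contactNumber_le_octahedralSix
  contactNumber_six isUnitBallPacking_octahedralSix sep_octa intContactNumber_octa sep_fccNucleus
  intContactNumber_fccNucleus)

variable {N : ℕ}

/-! ## Scaling by two -/

/-- Distances double under `x ↦ 2 • x`. -/
theorem dist_two_smul (u v : EuclideanSpace ℝ (Fin 3)) :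
    dist ((2 : ℝ) • u) ((2 : ℝ) • v) = 2 * dist u v := by
  rw [dist_smul₀, Real.norm_two]

/-- **R3 bridge, contact numbers**: the cell's contact number of `x` (pairs at distance `1`) is the
tree's `contactNumber` of the doubled configuration (pairs at distance `2`). -/
theorem numContacts_eq_contactNumber_two_smul (x : Fin N → EuclideanSpace ℝ (Fin 3)) :
    numContacts x = contactNumber (fun i => (2 : ℝ) • x i) := by
  classical
  unfold numContacts contactPairs contactNumber
  congr 1
  refine filter_congr fun p _ => ?_
  rw [dist_two_smul]
  constructor
  · rintro ⟨h1, h2⟩; exact ⟨h1, by rw [h2]; norm_num⟩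
  · rintro ⟨h1, h2⟩; exact ⟨h1, by linarith⟩

/-- **R3 bridge, packings**: `x` is a packing of diameter-`1` balls iff the doubled labelled
configuration is injective and its range is a packing of radius-`1` balls in the tree's sense. -/
theorem isUnitPacking_iff_two_smul (x : Fin N → EuclideanSpace ℝ (Fin 3)) :
    IsUnitPacking x ↔ Function.Injective (fun i => (2 : ℝ) • x i) ∧
      IsUnitBallPacking (Set.range fun i => (2 : ℝ) • x i) := by
  constructor
  · intro hx
    refine ⟨fun i j h => hx.injective (smul_right_injective _ (by norm_num : (2:ℝ) ≠ 0) h), ?_⟩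
    rintro _ ⟨i, rfl⟩ _ ⟨j, rfl⟩ hd
    by_contra hne
    have hij : i ≠ j := fun h => hne (h ▸ rfl)
    have h1 := hx hij
    rw [dist_two_smul] at hd
    linarith
  · rintro ⟨hinj, hP⟩ i j hij
    by_contra hlt
    have hd : dist ((2 : ℝ) • x i) ((2 : ℝ) • x j) < 2 := by
      rw [dist_two_smul]; linarith [not_le.1 hlt]
    exact hij (hinj (hP ⟨i, rfl⟩ ⟨j, rfl⟩ hd))

/-- Halving a radius-`1` labelled packing gives a diameter-`1` packing. -/
theorem isUnitPacking_half_smul {y : Fin N → EuclideanSpace ℝ (Fin 3)} (hy : Function.Injective y)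
    (hP : IsUnitBallPacking (Set.range y)) : IsUnitPacking (fun i => (1 / 2 : ℝ) • y i) := by
  rw [isUnitPacking_iff_two_smul]
  have h : (fun i => (2 : ℝ) • ((1 / 2 : ℝ) • y i)) = y := by
    funext i; rw [smul_smul]; norm_num
  rw [h]
  exact ⟨hy, hP⟩

/-- … with the same contact number. -/
theorem numContacts_half_smul (y : Fin N → EuclideanSpace ℝ (Fin 3)) :
    numContacts (fun i => (1 / 2 : ℝ) • y i) = contactNumber y := by
  rw [numContacts_eq_contactNumber_two_smul]
  congr 1
  funext i; rw [smul_smul]; norm_num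

/-- **Importing radius-`1` witnesses**: an injective labelled radius-`1` packing of the tree with
`k` contacts shows `k ≤ C(N)`. -/
theorem le_maxContacts_of_radiusOne {k : ℕ} {y : Fin N → EuclideanSpace ℝ (Fin 3)}
    (hy : Function.Injective y) (hP : IsUnitBallPacking (Set.range y))
    (hk : contactNumber y = k) : k ≤ maxContacts 3 N :=
  le_maxContacts_of_witness (isUnitPacking_half_smul hy hP) ((numContacts_half_smul y).trans hk)

/-- **Importing radius-`1` bounds**: a bound on `contactNumber` valid for all injective labelled
radius-`1` packings of `N` balls bounds `C(N)`. -/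
theorem maxContacts_le_of_radiusOne {B : ℕ}
    (h : ∀ y : Fin N → EuclideanSpace ℝ (Fin 3), Function.Injective y →
      IsUnitBallPacking (Set.range y) → contactNumber y ≤ B) :
    maxContacts 3 N ≤ B := by
  refine maxContacts_le (by norm_num) fun x hx => ?_
  obtain ⟨hinj, hP⟩ := (isUnitPacking_iff_two_smul x).1 hx
  rw [numContacts_eq_contactNumber_two_smul]
  exact h _ hinj hP

/-! ## Integer models at diameter `1` -/

/-- Distances in the integer model `i ↦ (1/√m) c(i)`: `√(n_ij / m)` with `n_ij = |c i - c j|²`. -/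
theorem dist_intConfig_inv_sqrt (c : Fin N → Fin 3 → ℤ) {m : ℕ} (hm : 0 < m) (i j : Fin N) :
    dist (intConfig c (1 / Real.sqrt m) i) (intConfig c (1 / Real.sqrt m) j) =
      Real.sqrt ((sqNormInt (c i - c j) : ℝ) / m) := by
  have hm' : (0 : ℝ) < Real.sqrt m := Real.sqrt_pos.2 (by exact_mod_cast hm)
  rw [dist_intConfig, abs_of_pos (by positivity), Real.sqrt_div' _ (Nat.cast_nonneg m)]
  ring

/-- **Contact counting in integer models** (diameter `1`, scale `1/√m`): the contact number is the
number of pairs at integer squared distance exactly `m` — kernel arithmetic. -/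
theorem numContacts_intConfig (c : Fin N → Fin 3 → ℤ) {m : ℕ} (hm : 0 < m) :
    numContacts (intConfig c (1 / Real.sqrt m)) = intContactNumber c m := by
  classical
  unfold numContacts contactPairs intContactNumber
  congr 1
  refine filter_congr fun p _ => ?_
  rw [dist_intConfig_inv_sqrt c hm, Real.sqrt_eq_one]
  have hmR : (0 : ℝ) < m := by exact_mod_cast hm
  rw [div_eq_one_iff_eq hmR.ne']
  constructor
  · rintro ⟨h1, h2⟩; exact ⟨h1, by exact_mod_cast h2⟩
  · rintro ⟨h1, h2⟩; exact ⟨h1, by exact_mod_cast h2⟩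

/-- **Packing in integer models**: if distinct labels are at integer squared distance `≥ m` then
the model at scale `1/√m` is a packing of diameter-`1` balls. -/
theorem isUnitPacking_intConfig (c : Fin N → Fin 3 → ℤ) {m : ℕ} (hm : 0 < m)
    (hsep : ∀ i j, i ≠ j → (m : ℤ) ≤ sqNormInt (c i - c j)) :
    IsUnitPacking (intConfig c (1 / Real.sqrt m)) := by
  intro i j hij
  rw [dist_intConfig_inv_sqrt c hm]
  have hmR : (0 : ℝ) < m := by exact_mod_cast hm
  have h1 : (1 : ℝ) ≤ (sqNormInt (c i - c j) : ℝ) / m := by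
    rw [le_div_iff₀ hmR, one_mul]; exact_mod_cast hsep i j hij
  simpa using Real.sqrt_le_sqrt h1

/-- **Integer witnesses give lower bounds**: a model with separation `≥ m` and `k` pairs at squared
distance `m` shows `k ≤ C(N)` in `ℝ³`. -/
theorem le_maxContacts_of_intConfig (c : Fin N → Fin 3 → ℤ) {m : ℕ} (hm : 0 < m)
    (hsep : ∀ i j, i ≠ j → (m : ℤ) ≤ sqNormInt (c i - c j)) {k : ℕ}
    (hk : intContactNumber c m = k) : k ≤ maxContacts 3 N :=
  le_maxContacts_of_witness (isUnitPacking_intConfig c hm hsep)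
    ((numContacts_intConfig c hm).trans hk)

/-! ## Imported tree facts -/

/-- `C(6) ≥ 12`: the regular octahedron (tree model `octaInt`, contact at squared distance `162`).
-/
theorem twelve_le_maxContacts_six : 12 ≤ maxContacts 3 6 :=
  le_maxContacts_of_intConfig octaInt (by norm_num) sep_octa intContactNumber_octa

/-- **`C(6) = 12`** (tree fact, imported through the bridge): the six-ball enumeration
(`ArkusHoy_sixSpheres_holds`, discharged in the tree) bounds every six-ball packing by the
octahedron's `12` contacts. -/
theorem maxContacts_three_six : maxContacts 3 6 = 12 := by
  refine le_antisymm ?_ twelve_le_maxContacts_six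
  refine maxContacts_le_of_radiusOne fun y hy hP => ?_
  have h := (contactNumber_le_octahedralSix y hy hP).1
  rwa [contactNumber_six.1] at h

/-- **fcc nuclei** (tree models `fccNucleusInt k`, contact at squared distance `2`):
`36 + 4k ≤ C(13 + k)` for `k ≤ 6`, i.e. `C(13) ≥ 36, C(14) ≥ 40, …, C(19) ≥ 60`. -/
theorem fccNucleus_le_maxContacts (k : Fin 7) : 36 + 4 * (k : ℕ) ≤ maxContacts 3 (13 + k) :=
  le_maxContacts_of_intConfig (fccNucleusInt k) (by norm_num) (sep_fccNucleus k)
    (intContactNumber_fccNucleus k)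

/-- In particular `C(13) ≥ 36` (centred cuboctahedron). -/
theorem thirtySix_le_maxContacts_thirteen : 36 ≤ maxContacts 3 13 :=
  fccNucleus_le_maxContacts 0

end Summit.Ventures.Crystal3D

end
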